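import Summits.ResolutionOfSingularities.ResolutionOfSingularities.Theorems.WeightedInvariantWeightedConstructionOffExceptional
import Mathlib.AlgebraicGeometry.Morphisms.Smooth
import Mathlib.AlgebraicGeometry.Morphisms.Separated
import Mathlib.AlgebraicGeometry.Morphisms.QuasiCompact
import Mathlib.AlgebraicGeometry.Morphisms.Affine
import HarnessLib

/-!
# Off the exceptional divisor the invariant of the FULL cobordant blow-up is the invariant downstairs

Topic: `Summits/ResolutionOfSingularities/ResolutionOfSingularities/Theorems`. Stub
`stub_fullBlowup_offExceptional` of the line `no-phi-rays-static-drop` of the crux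
`Theses.WeightedInvariant.WeightedConstruction` (statement `stmt-ResolutionOfSingularities-0571`)
of the summit `Summit.ResolutionOfSingularities.ResolutionOfSingularities`: the FULL-blow-up
analogue of the landed `stub_offExceptional`
(`Theorems/WeightedInvariantWeightedConstructionOffExceptional.lean`). Notation: `A = Γ(Y, U)`,
`I = R.chartIdeals U`, `E = A[t⁻¹, Iₙ tⁿ] = extReesAlgebra I ⊆ A[t, t⁻¹]`,
`s = t⁻¹ = extReesAlgebra.tInv I`, `B = B(U) = Spec E = affineCobordantBlowup I`
(Włodarczyk, arXiv:2203.03090, Def. 2.3.5), with structure map `B → Spec A ≅ U ⊆ Y → Spec k` and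
the ideal sheaf of the strict transform `σˢ(X(U))` (3.3.12).

* `stub_fullBlowup_offExceptional` — the stub (registered signature): at a point `b ∈ B(U)` with
  `s(b) ≠ 0`, `inv (B(U) → Spec k) σˢ(X(U))~ b = inv f X (image of b)`, for any rating `inv`
  functorial for smooth `k`-morphisms. Proof: the open `W = D(s) ⊆ B(U)` is the image of the open
  immersion `B₋ = Spec A[t, t⁻¹] → B` (`OffExceptional.range_awayι`), so `W → Y` factors through
  the smooth `Spec A[t, t⁻¹] → Spec A` and is smooth; on `W` the strict transform is the inverse
  image of `X` (`OffExceptional.comap_idealSheaf_strictTransform_awayι` and the tree's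
  `comap_fromSpec`); functoriality of `inv` along the smooth legs `W → B(U)` and `W → Y` concludes.

## Sources

* J. Włodarczyk, *Functorial resolution by torus actions*, arXiv:2203.03090, Def. 2.3.5, 3.3.12.
  [Wlodarczyk2022]
-/

noncomputable section

open CategoryTheory CategoryTheory.Limits AlgebraicGeometry TopologicalSpace
open Literature.AlgebraicGeometry.Resolution
open scoped LaurentPolynomial

set_option linter.dupNamespace false -- mandated namespace of this single-conjunct summit

namespace Summit.ResolutionOfSingularities.ResolutionOfSingularities.Theorems

open OffExceptional

/-- **Off the exceptional divisor, `inv` of the FULL cobordant blow-up is `inv` downstairs** (stub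
`stub_fullBlowup_offExceptional` of line `no-phi-rays-static-drop`, registered signature): for any
rating `inv` functorial for smooth `k`-morphisms (`k` perfect of characteristic `p`), any Rees
algebra `R` on a smooth separated quasi-compact `Y` over `k`, any affine chart `U` with
`B(U) = Spec Γ(Y,U)[t⁻¹, Rₙ(U) tⁿ] → U ⊆ Y → Spec k` smooth separated quasi-compact and any point
`b` of `B(U)` off `V(t⁻¹)`, the invariant of `(B(U), strict transform of X)` at `b` is the
invariant of `(Y, X)` at the image of `b` (Włodarczyk, Def. 2.3.5: `B ∖ V(t⁻¹) = X × 𝔾ₘ`, and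
3.3.12: off `V(t⁻¹)` the strict transform is the total transform).
[cite: Wlodarczyk2022, Def. 2.3.5 and 3.3.12] -/
theorem stub_fullBlowup_offExceptional :
    ∀ (p : ℕ) (Γ : Type) (inv : ∀ ⦃k : Type⦄ [Field k] ⦃Y : Scheme.{0}⦄, (Y ⟶ Spec (.of k)) →
      Y.IdealSheafData → Y → Γ),
    (∀ ⦃k : Type⦄ [Field k] [CharP k p] [PerfectField k] ⦃Y Y₁ : Scheme.{0}⦄ (f : Y ⟶ Spec (.of k))
      [Smooth f] [IsSeparated f] [QuasiCompact f] (f₁ : Y₁ ⟶ Spec (.of k)) [Smooth f₁] [IsSeparated f₁]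
      [QuasiCompact f₁] (g : Y₁ ⟶ Y) [Smooth g], g ≫ f = f₁ →
      ∀ (X : Y.IdealSheafData) (y₁ : Y₁), inv f₁ (X.comap g) y₁ = inv f X (g y₁)) →
    ∀ ⦃k : Type⦄ [Field k] [CharP k p] [PerfectField k] ⦃Y : Scheme.{0}⦄ (f : Y ⟶ Spec (.of k))
      [Smooth f] [IsSeparated f] [QuasiCompact f] (X : Y.IdealSheafData) (R : ReesAlgebraData Y)
      (U : Y.affineOpens),
      Smooth (affineCobordantBlowup.π (R.chartIdeals U) ≫ U.2.fromSpec ≫ f) →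
      IsSeparated (affineCobordantBlowup.π (R.chartIdeals U) ≫ U.2.fromSpec ≫ f) →
      QuasiCompact (affineCobordantBlowup.π (R.chartIdeals U) ≫ U.2.fromSpec ≫ f) →
      ∀ b : affineCobordantBlowup (R.chartIdeals U),
      b ∉ ((affineCobordantBlowup.exceptional (R.chartIdeals U)).support :
          Set (affineCobordantBlowup (R.chartIdeals U))) →
      inv (affineCobordantBlowup.π (R.chartIdeals U) ≫ U.2.fromSpec ≫ f)
          (affineCobordantBlowup.idealSheaf (R.chartIdeals U)
            (extReesAlgebra.strictTransform (R.chartIdeals U) (X.ideal U))) b =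
        inv f X ((affineCobordantBlowup.π (R.chartIdeals U) ≫ U.2.fromSpec) b) := by
  intro p Γ inv hcomap k _ _ _ Y f _ _ _ X R U hsm hsep hqc b hb
  haveI := hsm
  haveI := hsep
  haveI := hqc
  -- notation: `E = Γ(U)[t⁻¹, Rₙ(U) tⁿ]`, `B = Spec E`, `s = t⁻¹`
  haveI : IsAffine (affineCobordantBlowup (R.chartIdeals U)) := by
    unfold affineCobordantBlowup
    infer_instance
  -- the open `W = D(s)` of `B` and its point `b`
  let W : (affineCobordantBlowup (R.chartIdeals U)).Opens :=
    PrimeSpectrum.basicOpen (extReesAlgebra.tInv (R.chartIdeals U))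
  have hbW : b ∈ W := (not_mem_support_exceptional_iff (R.chartIdeals U) _).mp hb
  -- `W.ι` is quasi-compact: `W` is affine
  have hW : IsAffineOpen W :=
    IsAffineOpen.Spec_basicOpen (R := .of (extReesAlgebra (R.chartIdeals U)))
      (extReesAlgebra.tInv (R.chartIdeals U))
  haveI : IsAffine W := hW
  haveI : QuasiCompact W.ι := inferInstance
  -- the open immersion `l : W → Spec Γ(U)[t, t⁻¹]` (lift through `D(s) = Spec Γ(U)[t, t⁻¹]`)
  let aw : Spec (.of Γ(Y, U)[T;T⁻¹]) ⟶ affineCobordantBlowup (R.chartIdeals U) :=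
    Spec.map (CommRingCat.ofHom (algebraMap (extReesAlgebra (R.chartIdeals U)) Γ(Y, U)[T;T⁻¹]))
  haveI : IsOpenImmersion aw := isOpenImmersion_awayι (R.chartIdeals U)
  have hrange : Set.range W.ι ⊆ Set.range aw := by
    rw [Scheme.Opens.range_ι,
      show Set.range aw = (W : Set (affineCobordantBlowup (R.chartIdeals U))) from
        range_awayι (R.chartIdeals U)]
  obtain ⟨l, hl⟩ : ∃ l : (W : Scheme.{0}) ⟶ Spec (.of Γ(Y, U)[T;T⁻¹]), l ≫ aw = W.ι :=
    ⟨IsOpenImmersion.lift aw W.ι hrange, IsOpenImmersion.lift_fac aw W.ι hrange⟩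
  haveI : IsOpenImmersion l := by
    have : IsOpenImmersion (l ≫ aw) := by
      rw [hl]
      infer_instance
    exact IsOpenImmersion.of_comp l aw
  -- `W → Y` factors as `W → Spec Γ(U)[t, t⁻¹] → Spec Γ(U) → Y`, hence is smooth
  have hfac : W.ι ≫ affineCobordantBlowup.π (R.chartIdeals U) ≫ U.2.fromSpec =
      l ≫ Spec.map (CommRingCat.ofHom (algebraMap Γ(Y, U) Γ(Y, U)[T;T⁻¹])) ≫ U.2.fromSpec := by
    rw [← hl, Category.assoc, ← awayι_π (R.chartIdeals U), Category.assoc]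
    rfl
  haveI hsmg : Smooth (W.ι ≫ affineCobordantBlowup.π (R.chartIdeals U) ≫ U.2.fromSpec) := by
    rw [hfac]
    haveI := smooth_SpecMap_laurent (Γ(Y, U) : Type)
    infer_instance
  -- on `W` the strict transform is the inverse image of `X`
  have hd : (affineCobordantBlowup.idealSheaf (R.chartIdeals U)
      (extReesAlgebra.strictTransform (R.chartIdeals U) (X.ideal U))).comap W.ι =
      X.comap (W.ι ≫ affineCobordantBlowup.π (R.chartIdeals U) ≫ U.2.fromSpec) := by
    rw [← hl]
    simp only [Category.assoc, Scheme.IdealSheafData.comap_comp, comap_fromSpec]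
    rw [comap_idealSheaf_strictTransform_awayι]
  -- functoriality of `inv` along the two smooth legs `W → B` and `W → Y`
  have h1 := hcomap (affineCobordantBlowup.π (R.chartIdeals U) ≫ U.2.fromSpec ≫ f)
    (W.ι ≫ (affineCobordantBlowup.π (R.chartIdeals U) ≫ U.2.fromSpec ≫ f)) W.ι rfl
    (affineCobordantBlowup.idealSheaf (R.chartIdeals U)
      (extReesAlgebra.strictTransform (R.chartIdeals U) (X.ideal U))) ⟨b, hbW⟩
  have h2 := hcomap f (W.ι ≫ (affineCobordantBlowup.π (R.chartIdeals U) ≫ U.2.fromSpec ≫ f))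
    (W.ι ≫ affineCobordantBlowup.π (R.chartIdeals U) ≫ U.2.fromSpec)
    (by simp only [Category.assoc]) X ⟨b, hbW⟩
  rw [hd] at h1
  exact h1.symm.trans h2

end Summit.ResolutionOfSingularities.ResolutionOfSingularities.Theorems

end
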